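import Summits.AtomisticToContinuum.HydrodynamicLimit.Theorems.CorrectorPressureDecay.Negative.DiscreteCertificate
import Summits.AtomisticToContinuum.HydrodynamicLimit.Theorems.JParityClosureOddContactSymmetryGibbsInvariance
import Literature.Analysis.FluidPDE.HardSphereDynamicsProofs

/-!
# Negative knowledge for `CorrectorPressureDecay` (stmt-AtomisticToContinuum-14135): the crux implies
discrete-window pressure decay, hence the line's open stub (drefute gen 3, file 2/2)

Refuter `refuter-drefute-stmt-AtomisticToContinuum-14135-g3-0` (drefute gen 3 of the registered line
`Cruxes/CorrectorPressureDecay/Lines/kinetic-entropy-collision-budget.lean`), 2026-08-16. WHAT IS PROVED (sorry-free):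

  `discreteWindowPressureDecay_of_correctorPressureDecay : CorrectorPressureDecay → DiscreteWindowPressureDecay`
  `fastSectorDominance_of_correctorPressureDecay : OneBodyEntropyBudget → CorrectorPressureDecay → FastSectorDominance`

where `CorrectorPressureDecay` is the crux X itself (route decl, BY NAME) and `DiscreteWindowPressureDecay`,
`FastSectorDominance` (= the line's open stub 5, verbatim) and `OneBodyEntropyBudget` (= the line's stub 2, verbatim,
TRUE) are the statements of `Negative/FastSectorSandwichFrame.lean` (drefute gen 2). Together with the skeleton's own
sorry-free composition (stubs 1, 2, 3, 6 + stub 5 ⇒ X; stubs 1, 3, 4, 6 are landed tree theorems) this closes, INSIDE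
LEAN and without the shared wall 10967 or any continuous-window / joint-measurability / Riemann-sum argument, the loop
`X ⇒ DiscreteWindowPressureDecay ⇒ FastSectorDominance ⇒ X` (given the true stub 2): the open stub of the line is
EQUIVALENT to the crux; and X is equivalent to plain discrete-window pressure decay of fast one-body observables
(`DiscreteWindowPressureDecay ⇒ X` is the landed stub 6, `stub_discreteFejerCorrector`): the corrector / lag freedom
of X buys nothing.

MECHANISM. (1) the DISCRETE CERTIFICATE of file 1/2, transferred to `Φ.flow` along `μ(goodᶜ) = 0` via `flowMod Φ`;
(2) RIGHT-CONTINUITY OF THE KOOPMAN SHIFT: `∫|F∘Φ_u − F| dμ → 0` as `u ↓ 0` for continuous bounded `F` (good orbits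
are right-continuous, dominated convergence) and `∫|F∘Φ_{u+t} − F∘Φ_t| dμ = ∫|F∘Φ_u − F| dμ` (invariance); (3) given
X for the admissible observable `4g` at `δ := η` (corrector `W`, `lag`, cost scale `τ₀ℓ_N`) and `H ≥ H₁ := τ₀`, for
`n ≥ n₀(N, Φ)` put `m := ⌊n·lag/(Hℓ_N)⌋`: the certificate at spacing `lag/m ≥ Hℓ_N/n` is `≤ e^{η(N+1)}` (defect;
cost because `n·lag/m ≥ τ₀ℓ_N`) and its samples sit to the RIGHT of the window samples by `≤ Hℓ_N/m → 0`, whence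
`∫ exp(2A_n) ≤ (∫ exp(4A'_n))^½ (∫ exp(4(A_n − A'_n)))^½ ≤ e^{η(N+1)}`. Nothing here asserts a Theses decl.
-/

noncomputable section

open MeasureTheory ProbabilityTheory InformationTheory Set Filter Topology
open scoped ENNReal

namespace Summit.AtomisticToContinuum.HydrodynamicLimit.Theorems.CorrectorPressureDecayNegative.DiscreteWindow

open Literature.MathematicalPhysics.KineticTheory (T3 V3 hsDiameter localGibbsLaw)
open Literature.Analysis.FluidPDE (HardSphereFlow Config)
open Summit.AtomisticToContinuum.HydrodynamicLimit.Theorems.CorrectorPressureDecayNegative.FastSectorSandwich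
open Summit.AtomisticToContinuum.HydrodynamicLimit.Theorems.BoltzmannGreenKuboOrthMomentum
  (flowMod flowMod_of_mem measurable_flowMod)
open Summit.AtomisticToContinuum.HydrodynamicLimit.Theorems.AntiMazurCoboundariesExponentialCertificate
  (flowMod_add measurePreserving_flowMod)

/-! ## Hard-sphere flows: the certificate, right-continuity of the Koopman shift -/

section Concrete

variable {σ : ℝ} {N : ℕ}

/-- **The discrete exponential certificate for a hard-sphere flow**: for a flow-invariant probability law not
charging the bad set, measurable `F, W`, `lag > 0`, `m, n ≥ 1`,
`∫ exp(A'_n) dμ ≤ (∫ exp(2(F − lag⁻¹(W∘Φ_lag − W))) dμ)^½ (∫ exp((4m/(n·lag))|W|) dμ)^½`,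
`A'_n = n⁻¹ Σ_{j=1}^{n} F∘Φ_{j·lag/m}` (the abstract certificate for the modified flow `flowMod Φ`, transferred
along `μ(goodᶜ) = 0`). [folklore] -/
theorem discreteCertificate (Φ : Flow σ N) (μ : Measure (Phase N)) [IsProbabilityMeasure μ]
    (hinv : ∀ t, MeasurePreserving (Φ.flow t) μ μ) (hgood : μ Φ.goodᶜ = 0) {F W : Phase N → ℝ}
    (hF : Measurable F) (hW : Measurable W) {lag : ℝ} (hlag : 0 < lag) {m n : ℕ} (hm : 1 ≤ m) (hn : 1 ≤ n) :
    ∫⁻ z, ENNReal.ofReal (Real.exp (discAvg Φ F n (lag / m) z)) ∂μ ≤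
      (∫⁻ z, ENNReal.ofReal (Real.exp (2 * (F z - lag⁻¹ * (W (Φ.flow lag z) - W z)))) ∂μ) ^ (1 / 2 : ℝ) *
        (∫⁻ z, ENNReal.ofReal (Real.exp (4 * m / (n * lag) * |W z|)) ∂μ) ^ (1 / 2 : ℝ) := by
  have hae : ∀ᵐ z ∂μ, z ∈ Φ.good := (mem_ae_iff.2 hgood : Φ.good ∈ ae μ)
  have core := discreteCertificate_of_semigroup (flowMod Φ)
    (fun t => (measurable_flowMod Φ).comp measurable_prodMk_left) (flowMod_add Φ) μ
    (measurePreserving_flowMod Φ μ hinv hgood) hF hW hlag hm hn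
  have lhs : ∫⁻ z, ENNReal.ofReal (Real.exp (discAvg Φ F n (lag / m) z)) ∂μ =
      ∫⁻ z, ENNReal.ofReal (Real.exp ((n : ℝ)⁻¹ *
        ∑ j : Fin n, F (flowMod Φ ((((j : ℕ) : ℝ) + 1) * (lag / m), z)))) ∂μ := by
    refine lintegral_congr_ae ?_
    filter_upwards [hae] with z hz
    simp only [discAvg, flowMod_of_mem Φ hz]
  have rhs : ∫⁻ z, ENNReal.ofReal (Real.exp (2 * (F z - lag⁻¹ * (W (Φ.flow lag z) - W z)))) ∂μ =
      ∫⁻ z, ENNReal.ofReal (Real.exp (2 * (F z - lag⁻¹ * (W (flowMod Φ (lag, z)) - W z)))) ∂μ := by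
    refine lintegral_congr_ae ?_
    filter_upwards [hae] with z hz
    rw [flowMod_of_mem Φ hz]
  rw [lhs, rhs]
  exact core

/-- **Right-continuity of the Koopman shift in `L¹`**: for a probability law not charging the bad set and a
bounded continuous observable, `∫ |F∘Φ_u − F| dμ → 0` as `u ↓ 0` (good orbits are right-continuous; dominated
convergence). [folklore] -/
theorem tendsto_lintegral_abs_sub_flow (Φ : Flow σ N) (μ : Measure (Phase N)) [IsFiniteMeasure μ]
    (hgood : μ Φ.goodᶜ = 0) {F : Phase N → ℝ} (hFc : Continuous F) {C : ℝ} (hC : ∀ z, |F z| ≤ C) :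
    Tendsto (fun u : ℝ => ∫⁻ z, ENNReal.ofReal |F (Φ.flow u z) - F z| ∂μ) (𝓝[≥] 0) (𝓝 0) := by
  have hFm : Measurable F := hFc.measurable
  have hae : ∀ᵐ z ∂μ, z ∈ Φ.good := (mem_ae_iff.2 hgood : Φ.good ∈ ae μ)
  have hlim : ∀ᵐ z ∂μ, Tendsto (fun u : ℝ => ENNReal.ofReal |F (Φ.flow u z) - F z|) (𝓝[≥] 0)
      (𝓝 ((fun _ : Phase N => (0 : ℝ≥0∞)) z)) := by
    filter_upwards [hae] with z hz
    have h1 : ContinuousWithinAt (fun u => Φ.flow u z) (Ioi 0) 0 :=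
      (Φ.isTrajectory z hz).tendsto_nhdsGT torus_continuous_translate 0
    have h2 : Tendsto (fun u => Φ.flow u z) (𝓝[≥] 0) (𝓝 z) := by
      have h := continuousWithinAt_Ioi_iff_Ici.1 h1
      rw [ContinuousWithinAt, Φ.flow_zero z hz] at h
      exact h
    have h3 : Tendsto (fun u => F (Φ.flow u z) - F z) (𝓝[≥] 0) (𝓝 0) := by
      have h := ((hFc.tendsto z).comp h2).sub_const (F z)
      simpa using h
    have h4 : Tendsto (fun u => |F (Φ.flow u z) - F z|) (𝓝[≥] 0) (𝓝 0) := by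
      simpa using h3.abs
    simpa using ENNReal.tendsto_ofReal h4
  have h := tendsto_lintegral_filter_of_dominated_convergence (μ := μ) (l := 𝓝[≥] (0 : ℝ))
    (F := fun (u : ℝ) (z : Phase N) => ENNReal.ofReal |F (Φ.flow u z) - F z|) (f := fun _ => 0)
    (fun _ => ENNReal.ofReal (C + C))
    (Eventually.of_forall fun u => ((hFm.comp (Φ.measurable_flow u)).sub hFm).abs.ennreal_ofReal)
    (Eventually.of_forall fun u => ae_of_all _ fun z =>
      ENNReal.ofReal_le_ofReal ((abs_sub _ _).trans (add_le_add (hC _) (hC _))))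
    (by rw [lintegral_const]; exact ENNReal.mul_ne_top ENNReal.ofReal_ne_top (measure_ne_top μ _)) hlim
  simpa using h

/-- The modulus form: for every `ε > 0` there is `u₀ > 0` with `∫ |F∘Φ_u − F| dμ ≤ ε` for all `u ∈ [0, u₀]`.
[folklore] -/
theorem exists_shift_modulus (Φ : Flow σ N) (μ : Measure (Phase N)) [IsFiniteMeasure μ]
    (hgood : μ Φ.goodᶜ = 0) {F : Phase N → ℝ} (hFc : Continuous F) {C : ℝ} (hC : ∀ z, |F z| ≤ C)
    {ε : ℝ≥0∞} (hε : 0 < ε) :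
    ∃ u₀ : ℝ, 0 < u₀ ∧ ∀ u ∈ Icc (0 : ℝ) u₀, ∫⁻ z, ENNReal.ofReal |F (Φ.flow u z) - F z| ∂μ ≤ ε := by
  have h := tendsto_lintegral_abs_sub_flow Φ μ hgood hFc hC
  obtain ⟨δ, hδ, hδε⟩ :=
    Metric.eventually_nhds_iff.1 (eventually_nhdsWithin_iff.1 (h.eventually (gt_mem_nhds hε)))
  refine ⟨δ / 2, half_pos hδ, fun u hu => (hδε ?_ hu.1).le⟩
  rw [Real.dist_eq, sub_zero, abs_of_nonneg hu.1]
  linarith [hu.2]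

/-- **Invariance of the shift modulus**: `∫ |F∘Φ_{u+t} − F∘Φ_t| dμ = ∫ |F∘Φ_u − F| dμ` for a flow-invariant law
not charging the bad set. [folklore] -/
theorem lintegral_abs_sub_shift (Φ : Flow σ N) (μ : Measure (Phase N))
    (hinv : ∀ t, MeasurePreserving (Φ.flow t) μ μ) (hgood : μ Φ.goodᶜ = 0) {F : Phase N → ℝ}
    (hFm : Measurable F) (u t : ℝ) :
    ∫⁻ z, ENNReal.ofReal |F (Φ.flow (u + t) z) - F (Φ.flow t z)| ∂μ =
      ∫⁻ z, ENNReal.ofReal |F (Φ.flow u z) - F z| ∂μ := by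
  have hae : ∀ᵐ z ∂μ, z ∈ Φ.good := (mem_ae_iff.2 hgood : Φ.good ∈ ae μ)
  have hm : Measurable fun w => ENNReal.ofReal |F (Φ.flow u w) - F w| :=
    ((hFm.comp (Φ.measurable_flow u)).sub hFm).abs.ennreal_ofReal
  calc ∫⁻ z, ENNReal.ofReal |F (Φ.flow (u + t) z) - F (Φ.flow t z)| ∂μ
      = ∫⁻ z, (fun w => ENNReal.ofReal |F (Φ.flow u w) - F w|) (Φ.flow t z) ∂μ := by
        refine lintegral_congr_ae ?_
        filter_upwards [hae] with z hz
        simp only [Φ.flow_add u t z hz]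
    _ = ∫⁻ z, ENNReal.ofReal |F (Φ.flow u z) - F z| ∂μ := (hinv t).lintegral_comp hm

end Concrete

/-! ## The crux implies discrete-window pressure decay -/

set_option maxHeartbeats 1600000 in
/-- **X ⇒ discrete-window pressure decay.** `CorrectorPressureDecay` (stmt-14135, the crux, BY NAME) implies
`DiscreteWindowPressureDecay` (drefute gen 2's middle of the sandwich) at amplitude `κ/4`: the crux applied to the
admissible observable `4g` at `δ := η` gives `(τ₀, N₀)` and, for `N ≥ N₀` and each flow, `(lag, W)`; take `H₁ := τ₀`;
for a window `H ≥ H₁` and a sampling `n`, put `m := ⌊n·lag/(Hℓ_N)⌋`; the discrete certificate at spacing `lag/m` is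
`≤ e^{η(N+1)}` (defect clause, and cost clause since `n·lag/m ≥ Hℓ_N ≥ τ₀ℓ_N`), and the window samples differ from
the certificate samples by right shifts `≤ Hℓ_N/m`, whose exponential cost tends to `1` as `n → ∞` by the
right-continuity of the Koopman shift. No 10967, no continuous window, no Riemann sums. [folklore] -/
theorem discreteWindowPressureDecay_of_correctorPressureDecay
    (hX : Summit.AtomisticToContinuum.HydrodynamicLimit.Theses.AntiMazurCoboundaries.CorrectorPressureDecay) :
    DiscreteWindowPressureDecay := by
  intro a θ u₀ ha hθ
  obtain ⟨σ₀, hσ₀, HX⟩ := hX a θ u₀ ha hθ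
  refine ⟨σ₀, hσ₀, fun σ hσ hσlt => ?_⟩
  obtain ⟨hP, κ, hκ, Hκ⟩ := HX σ hσ hσlt
  refine ⟨κ / 4, by positivity, fun φ g hφ hg hφ1 hgκ horth η hη => ?_⟩
  -- the crux for the admissible observable `4g` at `δ := η`
  have hg4c : Continuous fun v => 4 * g v := continuous_const.mul hg
  have hg4b : ∀ v, |4 * g v| ≤ κ := fun v => by
    rw [abs_mul, abs_of_pos (by norm_num : (0 : ℝ) < 4)]
    linarith [hgκ v]
  obtain ⟨τ₀, hτ₀, N₀, HN⟩ := Hκ φ (fun v => 4 * g v) hφ hg4c hφ1 hg4b (orth_const_mul horth 4) η hη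
  refine ⟨τ₀, hτ₀, fun H hH => ⟨N₀, fun N hN Φ => ?_⟩⟩
  obtain ⟨lag, hlag, W, hWm, -, hdef, hcost⟩ := HN N hN Φ
  -- frame objects at fixed `(N, Φ)`
  haveI hGp : IsProbabilityMeasure (gibbs σ a θ u₀ N Φ) := hP N Φ
  have hinv : ∀ t, MeasurePreserving (Φ.flow t) (gibbs σ a θ u₀ N Φ) (gibbs σ a θ u₀ N Φ) := fun t =>
    measurePreserving_flow_localGibbsLaw_const σ a θ u₀ N Φ t
  have hgood : gibbs σ a θ u₀ N Φ Φ.goodᶜ = 0 := by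
    have hac : gibbs σ a θ u₀ N Φ ≪ Literature.Analysis.FluidPDE.liouville
        (Literature.Analysis.FluidPDE.Torus.geometry (Fin 3)) (N + 1) (hsDiameter σ N) := by
      show localGibbsLaw σ _ _ _ N Φ ≪ _
      rw [Literature.MathematicalPhysics.KineticTheory.localGibbsLaw_eq]
      exact Literature.MathematicalPhysics.KineticTheory.localGibbsMeasure_absolutelyContinuous σ _ _ _ N Φ
    exact hac Φ.measure_compl_good
  set G : Measure (Phase N) := gibbs σ a θ u₀ N Φ with hGdef
  have hHpos : 0 < H := hτ₀.trans_le hH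
  set ℓ : ℝ := scale N with hℓdef
  have hℓ : 0 < ℓ := Real.rpow_pos_of_pos (by positivity) _
  set T : ℝ := H * ℓ with hTdef
  have hT : 0 < T := mul_pos hHpos hℓ
  have hTh : τ₀ * ℓ ≤ T := mul_le_mul_of_nonneg_right hH hℓ.le
  set F : Phase N → ℝ := fluxObs θ u₀ φ g N with hFdef
  have hFc : Continuous F := continuous_fluxObs hφ hg N
  have hFm : Measurable F := measurable_fluxObs hφ hg N
  have hFb : ∀ z, |F z| ≤ (N + 1) * (κ / 4) := abs_fluxObs_le hφ1 hgκ N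
  have hF4m : Measurable (fluxObs θ u₀ φ (fun v => 4 * g v) N) := measurable_fluxObs hφ hg4c N
  -- the bound for `Y = 4(A_n − A'_n)` and the Koopman tolerance
  set B : ℝ := 4 * ((N + 1) * (κ / 4) + (N + 1) * (κ / 4)) with hBdef
  have hε₀pos : 0 < η / (4 * Real.exp B) := by positivity
  have hε₀ : (0 : ℝ≥0∞) < ENNReal.ofReal (η / (4 * Real.exp B)) := ENNReal.ofReal_pos.2 hε₀pos
  obtain ⟨u₁, hu₁, hmod⟩ := exists_shift_modulus Φ G hgood hFc hFb hε₀
  -- the sample threshold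
  refine ⟨⌈(T / u₁ + 2) * T / lag⌉₊ + 1, by omega, fun n hn => ?_⟩
  have hn1 : 1 ≤ n := le_trans (by omega) hn
  have hn_pos : (0 : ℝ) < n := by exact_mod_cast hn1
  have hnreal : (T / u₁ + 2) * T / lag ≤ n := by
    have h1 : ((⌈(T / u₁ + 2) * T / lag⌉₊ : ℕ) : ℝ) ≤ n := by exact_mod_cast (Nat.le_succ _).trans hn
    exact (Nat.le_ceil _).trans h1
  have hnlagT : T / u₁ + 2 ≤ n * lag / T := by
    rw [le_div_iff₀ hT]
    rw [div_le_iff₀ hlag] at hnreal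
    linarith
  -- the integer `m` and its bounds
  set m : ℕ := ⌊(n : ℝ) * lag / T⌋₊ with hmdef
  have hm_le : (m : ℝ) ≤ n * lag / T := Nat.floor_le (by positivity)
  have hm_gt : (n : ℝ) * lag / T < m + 1 := Nat.lt_floor_add_one _
  have hm_big : T / u₁ + 1 < m := by linarith
  have hTu : 0 < T / u₁ := div_pos hT hu₁
  have hm1 : 1 ≤ m := by
    have h1 : (1 : ℝ) < m := by linarith
    exact_mod_cast h1.le
  have hm_pos : (0 : ℝ) < m := by exact_mod_cast hm1
  -- `m·T ≤ n·lag < (m+1)·T`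
  have hmT : (m : ℝ) * T ≤ n * lag := by rwa [le_div_iff₀ hT] at hm_le
  have hmT' : (n : ℝ) * lag < (m + 1) * T := by rwa [div_lt_iff₀ hT] at hm_gt
  -- spacings: the window spacing `T/n` is at most the certificate spacing `lag/m`
  have hss : T / n ≤ lag / m := by
    rw [div_le_div_iff₀ hn_pos hm_pos]
    linarith
  -- offsets are at most `T/m < u₁`
  have hoff1 : (n : ℝ) * (lag / m - T / n) ≤ T / m := by
    have e1 : (n : ℝ) * (lag / m - T / n) = (n * lag - m * T) / m := by field_simp
    rw [e1, div_le_div_iff_of_pos_right hm_pos]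
    linarith
  have hoff2 : T / m < u₁ := by
    rw [div_lt_iff₀ hm_pos]
    have h1 : u₁ * (T / u₁ + 1) = T + u₁ := by field_simp
    have h2 := mul_lt_mul_of_pos_left hm_big hu₁
    linarith
  -- the certificate window is at least the cost scale: `τ₀ ℓ ≤ n·lag/m`
  have hwin : τ₀ * ℓ * m ≤ n * lag := by
    calc τ₀ * ℓ * m ≤ T * m := mul_le_mul_of_nonneg_right hTh hm_pos.le
      _ ≤ n * lag := by linarith [hmT]
  -- (1) the certificate for `4F`
  have cert := discreteCertificate Φ G hinv hgood hF4m hWm hlag hm1 hn1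
  have hdef' : ∫⁻ z, ENNReal.ofReal (Real.exp (2 * (fluxObs θ u₀ φ (fun v => 4 * g v) N z -
      lag⁻¹ * (W (Φ.flow lag z) - W z)))) ∂G ≤ ENNReal.ofReal (Real.exp (η * (N + 1))) := hdef
  have hcoef : 4 * (m : ℝ) / (n * lag) ≤ 4 * (τ₀ * ℓ)⁻¹ := by
    rw [div_le_iff₀ (by positivity)]
    have h1 : (m : ℝ) ≤ (τ₀ * ℓ)⁻¹ * (n * lag) := by
      rw [le_inv_mul_iff₀ (by positivity)]
      linarith
    linarith
  have hcost' : ∫⁻ z, ENNReal.ofReal (Real.exp (4 * m / (n * lag) * |W z|)) ∂G ≤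
      ENNReal.ofReal (Real.exp (η * (N + 1))) := by
    refine le_trans (lintegral_mono fun z => ENNReal.ofReal_le_ofReal (Real.exp_le_exp.2
      (mul_le_mul_of_nonneg_right hcoef (abs_nonneg _)))) ?_
    exact hcost
  have hA' : ∫⁻ z, ENNReal.ofReal (Real.exp (4 * discAvg Φ F n (lag / m) z)) ∂G ≤
      ENNReal.ofReal (Real.exp (η * (N + 1))) := by
    have e1 : ∀ z, 4 * discAvg Φ F n (lag / m) z = discAvg Φ (fluxObs θ u₀ φ (fun v => 4 * g v) N) n (lag / m) z :=
      fun z => (discAvg_fluxObs_const_mul Φ θ u₀ φ g 4 n (lag / m) z).symm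
    simp only [e1]
    refine cert.trans ?_
    calc (∫⁻ z, ENNReal.ofReal (Real.exp (2 * (fluxObs θ u₀ φ (fun v => 4 * g v) N z -
            lag⁻¹ * (W (Φ.flow lag z) - W z)))) ∂G) ^ (1 / 2 : ℝ) *
          (∫⁻ z, ENNReal.ofReal (Real.exp (4 * m / (n * lag) * |W z|)) ∂G) ^ (1 / 2 : ℝ)
        ≤ (ENNReal.ofReal (Real.exp (η * (N + 1)))) ^ (1 / 2 : ℝ) *
            (ENNReal.ofReal (Real.exp (η * (N + 1)))) ^ (1 / 2 : ℝ) :=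
          mul_le_mul' (ENNReal.rpow_le_rpow hdef' (by norm_num)) (ENNReal.rpow_le_rpow hcost' (by norm_num))
      _ = ENNReal.ofReal (Real.exp (η * (N + 1))) := by
          rw [← ENNReal.rpow_add_of_nonneg _ _ (by norm_num) (by norm_num)]
          norm_num
  -- (2) the sampling error `Y = 4 (A_n − A'_n)`
  set Y : Phase N → ℝ := fun z => 2 * (2 * (discAvg Φ F n (T / n) z - discAvg Φ F n (lag / m) z)) with hYdef
  have hAm : Measurable (discAvg Φ F n (T / n)) := measurable_discAvg Φ hFm n _
  have hA'm : Measurable (discAvg Φ F n (lag / m)) := measurable_discAvg Φ hFm n _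
  have hYm : Measurable Y := ((hAm.sub hA'm).const_mul 2).const_mul 2
  have hYb : ∀ z, |Y z| ≤ B := by
    intro z
    have h1 := abs_discAvg_le Φ hFb hn1 (T / n) z
    have h2 := abs_discAvg_le Φ hFb hn1 (lag / m) z
    rw [hYdef, hBdef]
    simp only
    rw [abs_mul, abs_mul, abs_two]
    have h3 := abs_sub (discAvg Φ F n (T / n) z) (discAvg Φ F n (lag / m) z)
    linarith
  have hYint : ∫⁻ z, ENNReal.ofReal |Y z| ∂G ≤ 4 * ENNReal.ofReal (η / (4 * Real.exp B)) := by
    -- pointwise: `|Y| ≤ 4 n⁻¹ Σ_j |F∘Φ_{t_j} − F∘Φ_{t'_j}|`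
    have pt : ∀ z, ENNReal.ofReal |Y z| ≤ ENNReal.ofReal (4 * (n : ℝ)⁻¹) *
        ∑ j : Fin n, ENNReal.ofReal |F (Φ.flow ((((j : ℕ) : ℝ) + 1) * (T / n)) z) -
          F (Φ.flow ((((j : ℕ) : ℝ) + 1) * (lag / m)) z)| := by
      intro z
      have e1 : Y z = 4 * (n : ℝ)⁻¹ * ∑ j : Fin n, (F (Φ.flow ((((j : ℕ) : ℝ) + 1) * (T / n)) z) -
          F (Φ.flow ((((j : ℕ) : ℝ) + 1) * (lag / m)) z)) := by
        rw [hYdef]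
        simp only [discAvg, Finset.sum_sub_distrib]
        ring
      have hle : |Y z| ≤ 4 * (n : ℝ)⁻¹ * ∑ j : Fin n, |F (Φ.flow ((((j : ℕ) : ℝ) + 1) * (T / n)) z) -
          F (Φ.flow ((((j : ℕ) : ℝ) + 1) * (lag / m)) z)| := by
        rw [e1, abs_mul, abs_of_pos (by positivity : (0 : ℝ) < 4 * (n : ℝ)⁻¹)]
        exact mul_le_mul_of_nonneg_left (Finset.abs_sum_le_sum_abs _ _) (by positivity)
      refine (ENNReal.ofReal_le_ofReal hle).trans (le_of_eq ?_)
      rw [ENNReal.ofReal_mul (by positivity), ENNReal.ofReal_sum_of_nonneg (fun j _ => abs_nonneg _)]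
    -- each term is a shift modulus at an offset `≤ T/m < u₁`
    have each : ∀ j : Fin n, ∫⁻ z, ENNReal.ofReal |F (Φ.flow ((((j : ℕ) : ℝ) + 1) * (T / n)) z) -
        F (Φ.flow ((((j : ℕ) : ℝ) + 1) * (lag / m)) z)| ∂G ≤ ENNReal.ofReal (η / (4 * Real.exp B)) := by
      intro j
      set u : ℝ := (((j : ℕ) : ℝ) + 1) * (lag / m - T / n) with hudef
      set t : ℝ := (((j : ℕ) : ℝ) + 1) * (T / n) with htdef
      have hj : (((j : ℕ) : ℝ) + 1) ≤ n := by
        have := j.isLt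
        exact_mod_cast this
      have hj0 : (0 : ℝ) < ((j : ℕ) : ℝ) + 1 := by positivity
      have hu0 : 0 ≤ u := mul_nonneg hj0.le (sub_nonneg.2 hss)
      have hu1 : u ≤ u₁ := by
        have h1 : u ≤ (n : ℝ) * (lag / m - T / n) :=
          mul_le_mul_of_nonneg_right hj (sub_nonneg.2 hss)
        linarith
      have e1 : (((j : ℕ) : ℝ) + 1) * (lag / m) = u + t := by rw [hudef, htdef]; ring
      rw [e1]
      calc ∫⁻ z, ENNReal.ofReal |F (Φ.flow t z) - F (Φ.flow (u + t) z)| ∂G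
          = ∫⁻ z, ENNReal.ofReal |F (Φ.flow (u + t) z) - F (Φ.flow t z)| ∂G :=
            lintegral_congr fun z => by rw [abs_sub_comm]
        _ = ∫⁻ z, ENNReal.ofReal |F (Φ.flow u z) - F z| ∂G := lintegral_abs_sub_shift Φ G hinv hgood hFm u t
        _ ≤ ENNReal.ofReal (η / (4 * Real.exp B)) := hmod u ⟨hu0, hu1⟩
    have hmeas : ∀ j : Fin n, Measurable fun z => ENNReal.ofReal |F (Φ.flow ((((j : ℕ) : ℝ) + 1) * (T / n)) z) -
        F (Φ.flow ((((j : ℕ) : ℝ) + 1) * (lag / m)) z)| := fun j =>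
      ((hFm.comp (Φ.measurable_flow _)).sub (hFm.comp (Φ.measurable_flow _))).abs.ennreal_ofReal
    calc ∫⁻ z, ENNReal.ofReal |Y z| ∂G
        ≤ ∫⁻ z, ENNReal.ofReal (4 * (n : ℝ)⁻¹) *
            ∑ j : Fin n, ENNReal.ofReal |F (Φ.flow ((((j : ℕ) : ℝ) + 1) * (T / n)) z) -
              F (Φ.flow ((((j : ℕ) : ℝ) + 1) * (lag / m)) z)| ∂G := lintegral_mono pt
      _ = ENNReal.ofReal (4 * (n : ℝ)⁻¹) *
            ∑ j : Fin n, ∫⁻ z, ENNReal.ofReal |F (Φ.flow ((((j : ℕ) : ℝ) + 1) * (T / n)) z) -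
              F (Φ.flow ((((j : ℕ) : ℝ) + 1) * (lag / m)) z)| ∂G := by
          rw [lintegral_const_mul _ (Finset.measurable_sum _ fun j _ => hmeas j),
            lintegral_finsetSum _ fun j _ => hmeas j]
      _ ≤ ENNReal.ofReal (4 * (n : ℝ)⁻¹) * ∑ _j : Fin n, ENNReal.ofReal (η / (4 * Real.exp B)) :=
          mul_le_mul' le_rfl (Finset.sum_le_sum fun j _ => each j)
      _ = 4 * ENNReal.ofReal (η / (4 * Real.exp B)) := by
          rw [Finset.sum_const, Finset.card_univ, Fintype.card_fin, nsmul_eq_mul, ← mul_assoc,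
            ENNReal.ofReal_mul (by norm_num : (0 : ℝ) ≤ 4), ENNReal.ofReal_ofNat, mul_assoc (4 : ℝ≥0∞),
            ENNReal.ofReal_inv_of_pos hn_pos, ENNReal.ofReal_natCast,
            ENNReal.inv_mul_cancel (by exact_mod_cast hn_pos.ne') (ENNReal.natCast_ne_top n), mul_one]
  have hYexp : ∫⁻ z, ENNReal.ofReal (Real.exp (Y z)) ∂G ≤ ENNReal.ofReal (Real.exp (η * (N + 1))) := by
    refine (lintegral_exp_le_one_add hYm hYb).trans ?_
    have h1 : ENNReal.ofReal (Real.exp B) * ∫⁻ z, ENNReal.ofReal |Y z| ∂G ≤ ENNReal.ofReal η := by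
      refine (mul_le_mul' le_rfl hYint).trans ?_
      rw [← ENNReal.ofReal_ofNat, ← ENNReal.ofReal_mul (by norm_num : (0 : ℝ) ≤ 4),
        ← ENNReal.ofReal_mul (Real.exp_nonneg _)]
      refine ENNReal.ofReal_le_ofReal (le_of_eq ?_)
      field_simp
    calc 1 + ENNReal.ofReal (Real.exp B) * ∫⁻ z, ENNReal.ofReal |Y z| ∂G
        ≤ 1 + ENNReal.ofReal η := add_le_add le_rfl h1
      _ = ENNReal.ofReal (η + 1) := by rw [ENNReal.ofReal_add hη.le zero_le_one, ENNReal.ofReal_one, add_comm]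
      _ ≤ ENNReal.ofReal (Real.exp (η * (N + 1))) := by
          refine ENNReal.ofReal_le_ofReal ((Real.add_one_le_exp η).trans (Real.exp_le_exp.2 ?_))
          have hN0 : (0 : ℝ) ≤ N := Nat.cast_nonneg N
          have hηN : 0 ≤ η * N := mul_nonneg hη.le hN0
          linarith
  -- (3) Cauchy–Schwarz and assembly
  have hfinal : ∫⁻ z, ENNReal.ofReal (Real.exp (2 * discAvg Φ F n (T / n) z)) ∂G ≤
      ENNReal.ofReal (Real.exp (η * (N + 1))) := by
    have e1 : ∀ z, 2 * discAvg Φ F n (T / n) z =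
        2 * discAvg Φ F n (lag / m) z + 2 * (discAvg Φ F n (T / n) z - discAvg Φ F n (lag / m) z) := fun z => by ring
    simp only [e1]
    refine (lintegral_exp_add_le (hA'm.const_mul 2) ((hAm.sub hA'm).const_mul 2)).trans ?_
    have e2 : ∀ z, 2 * (2 * discAvg Φ F n (lag / m) z) = 4 * discAvg Φ F n (lag / m) z := fun z => by ring
    simp only [e2]
    calc (∫⁻ z, ENNReal.ofReal (Real.exp (4 * discAvg Φ F n (lag / m) z)) ∂G) ^ (1 / 2 : ℝ) *
          (∫⁻ z, ENNReal.ofReal (Real.exp (Y z)) ∂G) ^ (1 / 2 : ℝ)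
        ≤ (ENNReal.ofReal (Real.exp (η * (N + 1)))) ^ (1 / 2 : ℝ) *
            (ENNReal.ofReal (Real.exp (η * (N + 1)))) ^ (1 / 2 : ℝ) :=
          mul_le_mul' (ENNReal.rpow_le_rpow hA' (by norm_num)) (ENNReal.rpow_le_rpow hYexp (by norm_num))
      _ = ENNReal.ofReal (Real.exp (η * (N + 1))) := by
          rw [← ENNReal.rpow_add_of_nonneg _ _ (by norm_num) (by norm_num)]
          norm_num
  -- back to the Bochner integral
  rw [integral_eq_lintegral_of_nonneg_ae (ae_of_all _ fun z => (Real.exp_pos _).le)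
    ((hAm.const_mul 2).exp.aestronglyMeasurable)]
  exact ENNReal.toReal_le_of_le_ofReal (Real.exp_pos _).le hfinal

/-- **The line's open stub is implied by the crux** (costume theorem, Lean-closed modulo the TRUE stub 2): with
`OneBodyEntropyBudget` (stub 2 of the line, verbatim), `CorrectorPressureDecay ⇒ FastSectorDominance` (stub 5, verbatim,
with `A = C = 0` at amplitude `κ/8`) — compose `discreteWindowPressureDecay_of_correctorPressureDecay` with drefute gen 2's
`fastSectorDominance_of_discreteWindowPressureDecay`. The converse `FastSectorDominance ⇒ CorrectorPressureDecay`
(given stubs 1, 2, 3, 6) is the skeleton's own sorry-free composition. [folklore] -/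
theorem fastSectorDominance_of_correctorPressureDecay (h₂ : OneBodyEntropyBudget)
    (hX : Summit.AtomisticToContinuum.HydrodynamicLimit.Theses.AntiMazurCoboundaries.CorrectorPressureDecay) :
    FastSectorDominance :=
  fastSectorDominance_of_discreteWindowPressureDecay h₂ (discreteWindowPressureDecay_of_correctorPressureDecay hX)


end Summit.AtomisticToContinuum.HydrodynamicLimit.Theorems.CorrectorPressureDecayNegative.DiscreteWindow

end
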